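import Literature.MathematicalPhysics.QuantumLattice.XYZGroundStateOrderSpinHalfHolds
import Literature.MathematicalPhysics.QuantumLattice.AnisotropicHeisenbergGaussianDomination
import HarnessLib

/-!
# Björnberg–Ueltschi: Gaussian domination at positive temperature for the anisotropic
# nearest-neighbour model (Corollary 5.3 as printed, `Z̃(v) ≤ Z̃(0)`)

Topic `MathematicalPhysics/QuantumLattice`; the positive-temperature twin of
`XYZGroundStateOrderGD.lean`. No statement of the tree is changed and no named fact is introduced;
everything here is a theorem.

J. E. Björnberg, D. Ueltschi, *Reflection positivity and infrared bounds for quantum spin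
systems*, in: The Physics and Mathematics of Elliott Lieb, vol. I, EMS Press (2022) 77–108 =
arXiv:2204.12896 [BjornbergUeltschi2022]. Their Theorem 3.2 is a statement at inverse temperature
`β < ∞` (the two lower bounds carry the thermal corrections `-(2βℓᵈ)⁻¹ Σ_{k≠0} ε(k)⁻¹ …`); the tree
(`XYZGroundStateOrder*.lean`) formalises its ground-state (`β = ∞`) consequence only, through the
ground-state Gaussian domination `E₀(H'(0)) ≤ E₀(H'(h))` (`xyz_gaussianDomination_real`). This file
proves the printed, positive-temperature Gaussian domination — B–U Corollary 5.3: "Under the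
assumption (5.11), we have for all `v ∈ ℝ^Λ` that `Z̃(v) ≤ Z̃(0)`", `Z̃(v) = Tr e^{-H(v) - β Σ (v_x - v_y)²/4}`
(eq. (5.17)) — for the nearest-neighbour Hamiltonian with couplings `(J₁, J₂, 1)`, `J₁ ≥ 0 ≥ J₂`
(B–U (5.16): "the measure `μ` needs to be positive, which is guaranteed by `J¹, J³ ≥ 0` and
`J² ≤ 0`"), in the tree's bond form `H'(h) = xyzRealFieldHamiltonian L n J₁ J₂ h` of
`XYZGroundStateOrderGD.lean` (field on the third component, B–U (5.15)):

* `xyz_partitionFn_sq_le` — the reflection inequality `Z_β(H'(h))² ≤ Z_β(H'(h^L)) Z_β(H'(h^R))`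
  along every pair of lattice planes (B–U Lemma 5.2 / [DLS1978] Lemma 4.1), from the Kronecker form
  `H'(h) = A ⊗ 1 + 1 ⊗ B - Σ Mᵢ ⊗ Nᵢ` of the tree (`xyzRealFieldHamiltonian_eq_submatrix`, real
  `A, B, Mᵢ, Nᵢ`) and the Dyson–Lieb–Simon trace inequality `Matrix.trace_exp_kroneckerSum_le`;
* `partitionFn_xyzRealField_le` — **Gaussian domination at `β < ∞`**: on even tori of side `L ≥ 4`,
  for `0 ≤ J₁`, `J₂ ≤ 0`, every spin, every `β > 0` and every real field `g`,
  `Z_β(H'(g)) ≤ Z_β(H'(0))`, by the descent of the tree stated once and for all in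
  `gaussianDomination_descent` (applied to `E = -Z_β(H'(·))`, exactly as for the antiferromagnet in
  `partitionFn_heisWeightedField_le`);
* `bu_thermalGaussianDomination` — the same inequality transported to the frame and shape consumed
  by the infrared-bound files (`xyz_infraredBound_of_groundEnergy_le` at `β = ∞`):
  `Z_β(H(1,J₂,J₁) - 2V⁰_h + Q(h)·1) ≤ Z_β(H(1,J₂,J₁))` for B–U's Hamiltonian
  `anisotropicTorus d L n 1 J₂ J₁` (order studied along the FIRST component), via the global quarter
  turn `rotV_conj_fieldHamiltonian`, `two_smul_xyzRealFieldHamiltonian` (`2H'(h)` is the doubled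
  bond form) and `Z_β(2K) = Z_{2β}(K)` (`Matrix.partitionFn_ofReal_smul` of the tree).

WHAT THIS IS NOT: no infrared bound, no long-range order (sequel files
`XYZThermalInfraredBound.lean`, `XYZThermalLongRangeOrder.lean`); nothing about the Hubbard model.

## References

* [BjornbergUeltschi2022] Lemma 5.1, Lemma 5.2 (nearest-neighbour case, eqs. (5.15)–(5.17)),
  Corollary 5.3, eq. (5.20).
* [DLS1978] F. J. Dyson, E. H. Lieb, B. Simon, J. Stat. Phys. 18 (1978) 335–383, Lemma 4.1,
  Thm. 4.2 (proof).
* [KLS1988JSP] T. Kennedy, E. H. Lieb, B. S. Shastry, J. Stat. Phys. 53 (1988) 1019–1030,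
  eqs. (17)–(25) (the ground-state version already in the tree).
-/

noncomputable section

open Matrix Finset Filter Topology NormedSpace
open scoped ComplexOrder Kronecker
open Literature.MathematicalPhysics.QuantumLattice Literature.MathematicalPhysics.QuantumLattice.SpinOperators
  Literature.Probability.LatticeModels Literature.Barriers.AtomisticToContinuum.BoseGas

namespace Literature.MathematicalPhysics.QuantumLattice

variable {d : ℕ}

/-! ### The reflection inequality for the partition function -/

section Reflection

variable (L : ℕ) [NeZero L] (j : Fin d) (a : ZMod L) (n : ℕ)

/-- **The reflection inequality for the partition function** (B–U Lemma 5.2 in the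
nearest-neighbour case (5.16); [DLS1978] Lemma 4.1 as used in the proof of Thm. 4.2): for the field
Hamiltonian `H'(h)` with couplings `J₁ = s₁²`, `J₂ = -s₂²` (third coupling `1`) on an even torus,
every pair of planes and every `β > 0`, `Z_β(H'(h))² ≤ Z_β(H'(h^L)) Z_β(H'(h^R))`. Proof: the
Kronecker form `H'(h) = A ⊗ 1 + 1 ⊗ B - Σᵢ Mᵢ ⊗ Nᵢ` with real `A, B, Mᵢ, Nᵢ`
(`xyzRealFieldHamiltonian_eq_submatrix`) and the Dyson–Lieb–Simon trace inequality
`Matrix.trace_exp_kroneckerSum_le`. [cite: BjornbergUeltschi2022, Lemma 5.1, Lemma 5.2]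
[cite: DLS1978, Lemma 4.1] -/
theorem xyz_partitionFn_sq_le (hL : Even L) {β : ℝ} (hβ : 0 < β) (s₁ s₂ : ℝ)
    (h : TorusSite d L → ℝ) :
    (partitionFn β (xyzRealFieldHamiltonian L n (s₁ ^ 2) (-(s₂ ^ 2)) h)).re ^ 2 ≤
      (partitionFn β (xyzRealFieldHamiltonian L n (s₁ ^ 2) (-(s₂ ^ 2)) (reflectFieldLeft L j a h))).re *
        (partitionFn β (xyzRealFieldHamiltonian L n (s₁ ^ 2) (-(s₂ ^ 2)) (reflectFieldRight L j a h))).re := by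
  set J₁ : ℝ := s₁ ^ 2 with hJ₁
  set J₂ : ℝ := -(s₂ ^ 2) with hJ₂
  haveI : Nonempty (TensorIndex (TorusSite d L) (n + 1)) := ⟨fun _ => 0⟩
  -- positivity of the three partition functions
  have hZpos : ∀ f : TorusSite d L → ℝ,
      0 < (partitionFn β (xyzRealFieldHamiltonian L n J₁ J₂ f)).re :=
    fun f => (Matrix.partitionFn_re_pos β (xyzRealFieldHamiltonian_isHermitian L n J₁ J₂ f)).1
  have hx0 := hZpos h
  have hy0 := hZpos (reflectFieldLeft L j a h)
  have hz0 := hZpos (reflectFieldRight L j a h)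
  -- abbreviations
  set A := xyzLeftHamiltonian L j a hL n J₁ J₂ h with hA
  set B := xyzLeftHamiltonian L j a hL n J₁ J₂ (fun y => h (Torus.reflectBetweenSites j a y)) with hB
  set M := xyzCrossOp L j a hL n s₁ s₂ h with hM
  set N := xyzCrossOp L j a hL n s₁ s₂ (fun y => h (Torus.reflectBetweenSites j a y)) with hN
  set e := torusSplit (q := n + 1) L j a hL with he
  -- the three Kronecker forms
  have hK : xyzRealFieldHamiltonian L n J₁ J₂ h = (A ⊗ₖ 1 + 1 ⊗ₖ B - ∑ i, M i ⊗ₖ N i).submatrix e e :=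
    xyzRealFieldHamiltonian_eq_submatrix L j a hL n s₁ s₂ h
  have hKL : xyzRealFieldHamiltonian L n J₁ J₂ (reflectFieldLeft L j a h) =
      (A ⊗ₖ 1 + 1 ⊗ₖ A - ∑ i, M i ⊗ₖ M i).submatrix e e := by
    rw [hJ₁, hJ₂, xyzRealFieldHamiltonian_eq_submatrix L j a hL n, ← hJ₁, ← hJ₂,
      xyzLeftHamiltonian_congr L j a n J₁ J₂ hL (fun x hx => reflectFieldLeft_of_mem L j a h hx),
      xyzLeftHamiltonian_congr L j a n J₁ J₂ hL
        (fun x hx => reflectFieldLeft_reflectBetweenSites_of_mem L j a hL h hx),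
      xyzCrossOp_congr L j a n hL s₁ s₂ (fun x hx => reflectFieldLeft_of_mem L j a h hx),
      xyzCrossOp_congr L j a n hL s₁ s₂
        (fun x hx => reflectFieldLeft_reflectBetweenSites_of_mem L j a hL h hx)]
  have hKR : xyzRealFieldHamiltonian L n J₁ J₂ (reflectFieldRight L j a h) =
      (B ⊗ₖ 1 + 1 ⊗ₖ B - ∑ i, N i ⊗ₖ N i).submatrix e e := by
    rw [hJ₁, hJ₂, xyzRealFieldHamiltonian_eq_submatrix L j a hL n, ← hJ₁, ← hJ₂,
      xyzLeftHamiltonian_congr L j a n J₁ J₂ hL (fun x hx => reflectFieldRight_of_mem L j a h hx),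
      xyzLeftHamiltonian_congr L j a n J₁ J₂ hL
        (h₁ := fun y => reflectFieldRight L j a h (Torus.reflectBetweenSites j a y))
        (fun x hx => reflectFieldRight_reflectBetweenSites_of_mem L j a hL h hx),
      xyzCrossOp_congr L j a n hL s₁ s₂ (fun x hx => reflectFieldRight_of_mem L j a h hx),
      xyzCrossOp_congr L j a n hL s₁ s₂
        (h₁ := fun y => reflectFieldRight L j a h (Torus.reflectBetweenSites j a y))
        (fun x hx => reflectFieldRight_reflectBetweenSites_of_mem L j a hL h hx)]
  -- partition functions as traces of exponentials of the DLS forms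
  have hZ : ∀ (X Y : Op (torusLeftHalf L j a) (n + 1))
      (P Q : torusCrossSites L j a × Fin 3 → Op (torusLeftHalf L j a) (n + 1)),
      partitionFn β ((X ⊗ₖ (1 : Op (torusLeftHalf L j a) (n + 1)) +
        (1 : Op (torusLeftHalf L j a) (n + 1)) ⊗ₖ Y - ∑ i, P i ⊗ₖ Q i).submatrix e e) =
      (exp ((-(β : ℂ) • X) ⊗ₖ (1 : Op (torusLeftHalf L j a) (n + 1)) +
        (1 : Op (torusLeftHalf L j a) (n + 1)) ⊗ₖ (-(β : ℂ) • Y) +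
        ∑ i, ((Real.sqrt β : ℂ) • P i) ⊗ₖ ((Real.sqrt β : ℂ) • Q i))).trace := by
    intro X Y P Q
    rw [Matrix.partitionFn_submatrix_equiv, partitionFn, gibbsWeight, neg_smul_kroneckerForm hβ.le]
  -- reality
  have hnegβ : ∀ {X : Op (torusLeftHalf L j a) (n + 1)}, Xᵀ = Xᴴ →
      (-(β : ℂ) • X)ᵀ = (-(β : ℂ) • X)ᴴ := by
    intro X hX
    have h' := transpose_eq_conjTranspose_ofReal_smul hX (-β)
    rwa [Complex.ofReal_neg] at h'
  have hAt : (-(β : ℂ) • A)ᵀ = (-(β : ℂ) • A)ᴴ :=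
    hnegβ (xyzLeftHamiltonian_transpose_eq L j a n J₁ J₂ hL h)
  have hBt : (-(β : ℂ) • B)ᵀ = (-(β : ℂ) • B)ᴴ :=
    hnegβ (xyzLeftHamiltonian_transpose_eq L j a n J₁ J₂ hL _)
  have hMt : ∀ i, ((Real.sqrt β : ℂ) • M i)ᵀ = ((Real.sqrt β : ℂ) • M i)ᴴ := fun i =>
    transpose_eq_conjTranspose_ofReal_smul (xyzCrossOp_transpose_eq L j a n hL s₁ s₂ h i) _
  have hNt : ∀ i, ((Real.sqrt β : ℂ) • N i)ᵀ = ((Real.sqrt β : ℂ) • N i)ᴴ := fun i =>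
    transpose_eq_conjTranspose_ofReal_smul (xyzCrossOp_transpose_eq L j a n hL s₁ s₂ _ i) _
  haveI : Nonempty (torusLeftHalf L j a → Fin (n + 1)) := ⟨fun _ => 0⟩
  have hDLS := Matrix.trace_exp_kroneckerSum_le (m := torusLeftHalf L j a → Fin (n + 1))
    (n := torusLeftHalf L j a → Fin (n + 1)) hAt hBt hMt hNt
  have hineq : (partitionFn β (xyzRealFieldHamiltonian L n J₁ J₂ h)).re ≤
      Real.sqrt (partitionFn β (xyzRealFieldHamiltonian L n J₁ J₂ (reflectFieldLeft L j a h))).re *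
      Real.sqrt (partitionFn β (xyzRealFieldHamiltonian L n J₁ J₂ (reflectFieldRight L j a h))).re := by
    rw [hK, hKL, hKR, hZ, hZ, hZ]
    exact hDLS
  calc _ ≤ (Real.sqrt (partitionFn β (xyzRealFieldHamiltonian L n J₁ J₂ (reflectFieldLeft L j a h))).re *
      Real.sqrt (partitionFn β (xyzRealFieldHamiltonian L n J₁ J₂ (reflectFieldRight L j a h))).re) ^ 2 :=
        pow_le_pow_left₀ hx0.le hineq 2
    _ = _ := by rw [mul_pow, Real.sq_sqrt hy0.le, Real.sq_sqrt hz0.le]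

end Reflection

/-! ### The descent: Gaussian domination at positive temperature -/

section Descent

variable (L : ℕ) [NeZero L] (n : ℕ)

/-- `x² ≤ yz` with `y, z ≥ 0` gives `x ≤ ½(y + z)` (geometric–arithmetic mean). [folklore] -/
private theorem le_half_add_of_sq_le_mul' {x y z : ℝ} (hy : 0 ≤ y) (hz : 0 ≤ z)
    (h : x ^ 2 ≤ y * z) : x ≤ (y + z) / 2 := by
  nlinarith [sq_nonneg (y - z), h, hy, hz, sq_nonneg (x - (y + z) / 2)]

/-- **Gaussian domination at positive temperature for the anisotropic nearest-neighbour model**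
(B–U Corollary 5.3, `Z̃(v) ≤ Z̃(0)`, as printed — i.e. at `β < ∞`), parametrised form: on the even
torus of side `L ≥ 4`, for couplings `J₁ = s₁²`, `J₂ = -s₂²` (third coupling `1`), every spin,
every `β > 0` and every real field `g`, `Z_β(H'(g)) ≤ Z_β(H'(0))`. Proof: the descent
`gaussianDomination_descent` applied to `E = -Z_β(H'(·))`, the reflection inequality being
`Z(h) ≤ √(Z(h^L)Z(h^R)) ≤ ½(Z(h^L) + Z(h^R))` (`xyz_partitionFn_sq_le`), and `H'(h) = H'(0)` for
fields constant on bonds (`xyzRealFieldHamiltonian_eq_of_badBondCount_eq_zero`).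
[cite: BjornbergUeltschi2022, Corollary 5.3] [cite: DLS1978, Thm. 4.2 (proof)] -/
theorem partitionFn_xyzRealField_le_sq (hL : Even L) (h4 : 4 ≤ L) {β : ℝ} (hβ : 0 < β) (s₁ s₂ : ℝ)
    (g : TorusSite d L → ℝ) :
    (partitionFn β (xyzRealFieldHamiltonian (d := d) L n (s₁ ^ 2) (-(s₂ ^ 2)) g)).re ≤
      (partitionFn β (xyzRealFieldHamiltonian (d := d) L n (s₁ ^ 2) (-(s₂ ^ 2)) (fun _ => 0))).re := by
  haveI : Nonempty (TensorIndex (TorusSite d L) (n + 1)) := ⟨fun _ => 0⟩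
  have hZpos : ∀ f : TorusSite d L → ℝ,
      0 < (partitionFn β (xyzRealFieldHamiltonian L n (s₁ ^ 2) (-(s₂ ^ 2)) f)).re :=
    fun f => (Matrix.partitionFn_re_pos β (xyzRealFieldHamiltonian_isHermitian L n _ _ f)).1
  have h := gaussianDomination_descent L hL h4
    (fun f => -(partitionFn β (xyzRealFieldHamiltonian L n (s₁ ^ 2) (-(s₂ ^ 2)) f)).re)
    (fun j a f => by
      have h3 := le_half_add_of_sq_le_mul' (hZpos (reflectFieldLeft L j a f)).le
        (hZpos (reflectFieldRight L j a f)).le (xyz_partitionFn_sq_le L j a n hL hβ s₁ s₂ f)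
      linarith)
    (fun f hf => by
      simp only [xyzRealFieldHamiltonian_eq_of_badBondCount_eq_zero L n _ _ hf]) g
  linarith

/-- **Gaussian domination at positive temperature**, stated with the couplings: for `0 ≤ J₁`,
`J₂ ≤ 0` (third coupling `1`), even side `L ≥ 4`, all spins, every `β > 0` and all real fields `g`,
`Z_β(H'(g)) ≤ Z_β(H'(0))` — B–U Corollary 5.3 for the nearest-neighbour model ((5.16): positivity
of the measure "is guaranteed by `J¹, J³ ≥ 0` and `J² ≤ 0`"). [cite: BjornbergUeltschi2022, Corollary 5.3] -/
theorem partitionFn_xyzRealField_le (hL : Even L) (h4 : 4 ≤ L) {β : ℝ} (hβ : 0 < β) {J₁ J₂ : ℝ}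
    (hJ₁ : 0 ≤ J₁) (hJ₂ : J₂ ≤ 0) (g : TorusSite d L → ℝ) :
    (partitionFn β (xyzRealFieldHamiltonian (d := d) L n J₁ J₂ g)).re ≤
      (partitionFn β (xyzRealFieldHamiltonian (d := d) L n J₁ J₂ (fun _ => 0))).re := by
  have h1 : J₁ = Real.sqrt J₁ ^ 2 := (Real.sq_sqrt hJ₁).symm
  have h2 : J₂ = -(Real.sqrt (-J₂) ^ 2) := by rw [Real.sq_sqrt (by linarith)]; ring
  rw [h1, h2]
  exact partitionFn_xyzRealField_le_sq L n hL h4 hβ _ _ g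

end Descent

/-! ### Transport to the frame and shape consumed by the infrared bound -/

section Transport

variable (L : ℕ) [NeZero L] (n : ℕ)

/-- **Thermal Gaussian domination in the shape consumed by the infrared-bound assembly** (B–U
Cor. 5.3 / (5.20) at `β < ∞`, transported): on even tori of side `L ≥ 4`, for `0 ≤ J₁`, `J₂ ≤ 0`,
all spins, every `β > 0` and all real fields `h`,
`Z_β(H(1,J₂,J₁) - 2V⁰_h + Q(h)·1) ≤ Z_β(H(1,J₂,J₁))` for B–U's Hamiltonian
`H(1,J₂,J₁) = anisotropicTorus d L n 1 J₂ J₁` (first component carrying the unit coupling),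
`V⁰_h = xyGradField L n h`, `Q(h) = xyFieldEnergy L h`:
`Z_β(H(1,J₂,J₁) - 2V⁰_h + Q(h)·1) = Z_β(W(H(J₁,J₂,1) - 2V²_h + Q(h)·1)Wᴴ) = Z_β(2H'(h)) = Z_{2β}(H'(h))
≤ Z_{2β}(H'(0)) = Z_β(H(1,J₂,J₁))`, `W` the global quarter turn (`rotV_conj_fieldHamiltonian`).
[cite: BjornbergUeltschi2022, Cor. 5.3 and (5.20)] -/
theorem bu_thermalGaussianDomination (hL : Even L) (h4 : 4 ≤ L) {β : ℝ} (hβ : 0 < β) {J₁ J₂ : ℝ}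
    (hJ₁ : 0 ≤ J₁) (hJ₂ : J₂ ≤ 0) (h : TorusSite d L → ℝ) :
    (partitionFn β (anisotropicTorus d L n 1 J₂ J₁ - (2 : ℂ) • xyGradField L n h +
        ((xyFieldEnergy L h : ℝ) : ℂ) • (1 : Op (TorusSite d L) (n + 1)))).re ≤
      (partitionFn β (anisotropicTorus d L n 1 J₂ J₁)).re := by
  have hL3 : 3 ≤ L := by omega
  obtain ⟨V, hV, hV', hVz, hVx, hVy⟩ := exists_unitary_conj_spinZ_eq_spinX n
  set W : Op (TorusSite d L) (n + 1) := productOp (fun _ : TorusSite d L => V) with hW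
  have hWu : W ∈ Matrix.unitaryGroup (TensorIndex (TorusSite d L) (n + 1)) ℂ :=
    Matrix.mem_unitaryGroup_iff.2 (productOp_mul_conjTranspose fun _ => hV)
  have key : ∀ g : TorusSite d L → ℝ,
      partitionFn β (anisotropicTorus d L n 1 J₂ J₁ - (2 : ℂ) • xyGradField L n g +
          ((xyFieldEnergy L g : ℝ) : ℂ) • 1) =
        partitionFn (β * 2) (xyzRealFieldHamiltonian L n J₁ J₂ g) := by
    intro g
    rw [← rotV_conj_fieldHamiltonian L n hV hV' hVz hVx hVy J₁ J₂ g (xyFieldEnergy L g),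
      ← Matrix.star_eq_conjTranspose, Matrix.partitionFn_unitary_conj hWu,
      ← two_smul_xyzRealFieldHamiltonian L n hL3, show (2 : ℂ) = ((2 : ℝ) : ℂ) by norm_num,
      Matrix.partitionFn_ofReal_smul]
  have h0 : anisotropicTorus d L n 1 J₂ J₁ =
      anisotropicTorus d L n 1 J₂ J₁ - (2 : ℂ) • xyGradField L n (fun _ : TorusSite d L => (0 : ℝ)) +
        ((xyFieldEnergy L (fun _ : TorusSite d L => (0 : ℝ)) : ℝ) : ℂ) • 1 := by
    simp [xyGradField, xyFieldEnergy]
  have hβ2 : 0 < β * 2 := by positivity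
  calc (partitionFn β (anisotropicTorus d L n 1 J₂ J₁ - (2 : ℂ) • xyGradField L n h +
        ((xyFieldEnergy L h : ℝ) : ℂ) • 1)).re
      = (partitionFn (β * 2) (xyzRealFieldHamiltonian L n J₁ J₂ h)).re := by rw [key h]
    _ ≤ (partitionFn (β * 2) (xyzRealFieldHamiltonian L n J₁ J₂ (fun _ => 0))).re :=
        partitionFn_xyzRealField_le L n hL h4 hβ2 hJ₁ hJ₂ h
    _ = (partitionFn β (anisotropicTorus d L n 1 J₂ J₁ -
          (2 : ℂ) • xyGradField L n (fun _ : TorusSite d L => (0 : ℝ)) +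
          ((xyFieldEnergy L (fun _ : TorusSite d L => (0 : ℝ)) : ℝ) : ℂ) • 1)).re := by rw [key]
    _ = (partitionFn β (anisotropicTorus d L n 1 J₂ J₁)).re := by rw [← h0]

end Transport

end Literature.MathematicalPhysics.QuantumLattice

end
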